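import Literature.Analysis.FluidPDE.PassiveScalarEnergySlice
import Literature.Analysis.FunctionSpaces.TorusMollifierHolder
import Literature.Analysis.FunctionSpaces.TorusSpaceTimeConvolution
import Literature.Analysis.FunctionSpaces.TorusFluidGlueProofs
import HarnessLib

/-!
# The mollified scalar energy flux in Hölder classes: the commutator form of the transport pairing

Analysis/FluidPDE proof-support file serving the discharge of the Obukhov–Corrsin threshold
`Literature.Barriers.AnomalousDissipation.DrivasElgindiIyerJeong2022_thm4`
(`Barriers/AnomalousDissipation/ObukhovCorrsinThreshold`; Drivas–Elgindi–Iyer–Jeong 2022, Thm. 4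
and its proof, (5.8)–(5.10)). It contains the time-independent slice computation. For a
continuous scalar `δ = θ(s)`, a bounded measurable weakly divergence-free field `v = u(s)`, the
torus mollifier `k = kernel ε`, `A = δ ⋆ k`, `B = A ⋆ k`, and the flux
`G(x) = ∫ δ(y) (-⟪v y, ∇k(x-y)⟫ + κ Δk(x-y)) dy` of the mollified equation
(`PassiveScalarEnergySlice`: `∫ A G = ∫ δ ⟪v, ∇B⟫ - κ ∫ ‖∇A‖²`):

* `integral_mul_inner_gradient_conv_conv_eq_sum` — **the transport pairing in commutator form**:
  `∫ δ ⟪v, ∇B⟫ = ∑ⱼ ∫ ∂ⱼA · τⱼ` with the Constantin–E–Titi commutator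
  `τⱼ = (vⱼ δ) ⋆ k - (vⱼ ⋆ k) (δ ⋆ k)` (adjointness of mollification by the even kernel,
  `∂ⱼB = ∂ⱼA ⋆ k`, and `∫ A ⟪v ⋆ k, ∇A⟫ = 0` because `v ⋆ k` is divergence free); this is the
  term `∫ ∇θ̄_ℓ · τ_ℓ(u, θ)` of DEIJ 2022, (5.9);
* `neg_integral_conv_mul_flux_le_of_holderWith` — **the slice bound in Hölder classes**: for
  `δ ∈ C^β` (constant `C_θ`) and `v ∈ C^α` (constant `C_u`),
  `κ ∫ ‖∇A‖² - ∫ δ ⟪v, ∇B⟫ ≤ d P Q + κ d P²` with `P = (C₁/ε) C_θ ε^β ≥ sup |∂ⱼA|` and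
  `Q = 2 C_u ε^α C_θ ε^β ≥ sup |τⱼ|` (DEIJ 2022, (5.10): the bounds
  `ℓ^{α+2β-1} [θ]²_β [u]_α + κ ℓ^{2β-2} [θ]²_β` per unit time).

## Mathlib / tree search

Mathlib (this pin): no mollifier commutators (searched `commutator` + `convolution`). Tree:
`PassiveScalarEnergySlice` (`integral_conv_mul_flux_eq`, `partialDeriv_conv_kernel_eq`),
`TorusSpaceTimeConvolution` (`integral_mul_convolution_comm`), `TorusCommutatorEstimate`
(`isDivFree_vecMollify`), `TorusFluidGlueProofs` (`IsDivFree.isWeaklyDivFree_holds`),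
`PassiveScalarProofs` (`integral_mul_inner_gradient_eq_zero`), `TorusMollifierHolder` (sup-norm
CET estimates), `TorusTrigPoly` (`inner_gradient_eq_sum_mul_partialDeriv`).

## References

* T. D. Drivas, T. M. Elgindi, G. Iyer, I.-J. Jeong, *Anomalous dissipation in passive scalar
  transport*, Arch. Ration. Mech. Anal. 243 (2022), 1151–1180 (arXiv:1911.03271), Thm. 4 and its
  proof, (5.8)–(5.10) (arXiv numbering). Bib key `DrivasEtAl2022`.
* P. Constantin, W. E, E. S. Titi, Comm. Math. Phys. 165 (1994), 207–209, (9)–(11). Bib key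
  `ConstantinETiti1994`.
-/

noncomputable section

open MeasureTheory TopologicalSpace Set Function Filter Metric ContinuousLinearMap
open scoped ENNReal NNReal Convolution InnerProductSpace

namespace Literature.Analysis.FluidPDE

namespace Torus

variable {d : Type*} [Fintype d] [DecidableEq d]

section Slice

variable {δ : UnitAddTorus d → ℝ} {v : UnitAddTorus d → EuclideanSpace ℝ d} {ε Cv : ℝ}

omit [DecidableEq d] in
/-- A bounded measurable field on `T^d` is integrable, and so are its coordinates and their
products with a continuous scalar. [folklore] -/
theorem integrable_apply_mul_of_norm_le (hδ : Continuous δ) (hv : AEStronglyMeasurable v volume)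
    (hCv : ∀ y, ‖v y‖ ≤ Cv) (j : d) :
    Integrable v volume ∧ Integrable (fun y => v y j) volume ∧
      Integrable (fun y => v y j * δ y) volume := by
  have hvi : Integrable v volume :=
    Integrable.mono' (integrable_const Cv) hv (Eventually.of_forall hCv)
  have hvj : Integrable (fun y => v y j) volume := hvi.eval_piLp j
  refine ⟨hvi, hvj, ?_⟩
  exact hδ.integrable_unitAddTorus.bdd_mul hvj.aestronglyMeasurable
    (Eventually.of_forall fun y => (PiLp.norm_apply_le (v y) j).trans (hCv y))

/-- **The transport pairing in commutator form** (the term `∫ ∇θ̄_ℓ · τ_ℓ(u,θ)` of DEIJ 2022,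
(5.9)): for continuous `δ`, bounded measurable weakly divergence-free `v`, `k = kernel ε`,
`A = δ ⋆ k`, `B = A ⋆ k`,
`∫ δ ⟪v, ∇B⟫ = ∑ⱼ ∫ ∂ⱼA (x) · (((vⱼ δ) ⋆ k)(x) - (vⱼ ⋆ k)(x) A(x)) dx`
(`⟪v, ∇B⟫ = ∑ⱼ vⱼ ∂ⱼB`, `∂ⱼB = ∂ⱼA ⋆ k`, adjointness `∫ f (g ⋆ k) = ∫ (f ⋆ k) g` for the even
kernel, and `∑ⱼ ∫ ∂ⱼA (vⱼ ⋆ k) A = ∫ A ⟪v^ε, ∇A⟫ = 0` since the mollified field `v^ε` is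
divergence free). [cite: DrivasEtAl2022, proof of Thm. 4, (5.8)–(5.9)] -/
theorem integral_mul_inner_gradient_conv_conv_eq_sum (hδ : Continuous δ)
    (hv : AEStronglyMeasurable v volume) (hCv : ∀ y, ‖v y‖ ≤ Cv)
    (hdiv : FunctionSpaces.Torus.IsWeaklyDivFree v) (hε : 0 < ε) (hε' : ε ≤ 1 / 4) :
    ∫ y, δ y * ⟪v y, FunctionSpaces.Torus.gradient
        ((δ ⋆ FunctionSpaces.Torus.kernel ε) ⋆ FunctionSpaces.Torus.kernel ε) y⟫_ℝ =
      ∑ j, ∫ x, FunctionSpaces.Torus.partialDeriv j (δ ⋆ FunctionSpaces.Torus.kernel ε) x *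
        (((fun y => v y j * δ y) ⋆ FunctionSpaces.Torus.kernel ε) x -
          ((fun y => v y j) ⋆ FunctionSpaces.Torus.kernel ε) x *
            (δ ⋆ FunctionSpaces.Torus.kernel ε) x) := by
  set k : UnitAddTorus d → ℝ := FunctionSpaces.Torus.kernel ε with hk_def
  have hk : FunctionSpaces.Torus.IsSmooth k := FunctionSpaces.Torus.isSmooth_kernel hε hε'
  have hkc : Continuous k := hk.continuous
  have hδi : Integrable δ volume := hδ.integrable_unitAddTorus
  have hA : FunctionSpaces.Torus.IsSmooth (δ ⋆ k) := FunctionSpaces.Torus.isSmooth_convolution hδi hk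
  have hA1 : FunctionSpaces.Torus.IsContDiff 1 (δ ⋆ k) := hA.isContDiff (by simp)
  have hB : FunctionSpaces.Torus.IsSmooth ((δ ⋆ k) ⋆ k) :=
    FunctionSpaces.Torus.isSmooth_convolution hA.integrable hk
  have hB1 : FunctionSpaces.Torus.IsContDiff 1 ((δ ⋆ k) ⋆ k) := hB.isContDiff (by simp)
  have hvI := fun j => integrable_apply_mul_of_norm_le hδ hv hCv j
  have hvi : Integrable v volume :=
    Integrable.mono' (integrable_const Cv) hv (Eventually.of_forall hCv)
  -- Step 1: `δ ⟪v, ∇B⟫ = ∑ⱼ (vⱼ δ) (∂ⱼA ⋆ k)` pointwise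
  have hstep1 : ∀ y, δ y * ⟪v y, FunctionSpaces.Torus.gradient ((δ ⋆ k) ⋆ k) y⟫_ℝ =
      ∑ j, (v y j * δ y) * (FunctionSpaces.Torus.partialDeriv j (δ ⋆ k) ⋆ k) y := by
    intro y
    rw [FunctionSpaces.Torus.inner_gradient_eq_sum_mul_partialDeriv hB1, Finset.mul_sum]
    refine Finset.sum_congr rfl fun j _ => ?_
    rw [partialDeriv_conv_kernel_eq hA hε hε' j y]
    ring
  have hI : ∀ j, Integrable (fun y => (v y j * δ y) * (FunctionSpaces.Torus.partialDeriv j (δ ⋆ k) ⋆ k) y)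
      volume := by
    intro j
    have hc : Continuous (FunctionSpaces.Torus.partialDeriv j (δ ⋆ k) ⋆ k) :=
      FunctionSpaces.Torus.continuous_convolution (hA.partialDeriv j).integrable hkc
    obtain ⟨C, hC⟩ := FunctionSpaces.Torus.exists_forall_norm_le_of_continuous hc
    exact (hvI j).2.2.mul_bdd hc.aestronglyMeasurable (Eventually.of_forall hC)
  -- Step 2: integrate, and move the kernel onto `vⱼ δ` by adjointness
  have hlhs : ∫ y, δ y * ⟪v y, FunctionSpaces.Torus.gradient ((δ ⋆ k) ⋆ k) y⟫_ℝ =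
      ∑ j, ∫ x, ((fun y => v y j * δ y) ⋆ k) x * FunctionSpaces.Torus.partialDeriv j (δ ⋆ k) x := by
    rw [integral_congr_ae (Eventually.of_forall hstep1), integral_finsetSum _ fun j _ => hI j]
    refine Finset.sum_congr rfl fun j _ => ?_
    exact FunctionSpaces.Torus.integral_mul_convolution_comm (hvI j).2.2 (hA.partialDeriv j).integrable hkc
      (FunctionSpaces.Torus.kernel_neg hε hε')
  -- Step 3: the resolved transport term vanishes, `∫ A ⟪v^ε, ∇A⟫ = 0`
  have hmoll : FunctionSpaces.Torus.IsWeaklyDivFree (FunctionSpaces.Torus.vecMollify ε v) :=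
    (FunctionSpaces.Torus.isDivFree_vecMollify hvi hdiv hε hε').isWeaklyDivFree_holds
      (FunctionSpaces.Torus.isSmooth_vecMollify hvi hε hε')
  have hJ : ∀ j, Integrable (fun x => ((fun y => v y j) ⋆ k) x * (δ ⋆ k) x *
      FunctionSpaces.Torus.partialDeriv j (δ ⋆ k) x) volume := fun j =>
    (((FunctionSpaces.Torus.continuous_convolution (hvI j).2.1 hkc).mul hA.continuous).mul
      (hA.partialDeriv j).continuous).integrable_unitAddTorus
  have hzero : ∑ j, ∫ x, ((fun y => v y j) ⋆ k) x * (δ ⋆ k) x *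
      FunctionSpaces.Torus.partialDeriv j (δ ⋆ k) x = 0 := by
    have h0 := integral_mul_inner_gradient_eq_zero hA hmoll
    have hpt : ∀ x, (δ ⋆ k) x * ⟪FunctionSpaces.Torus.vecMollify ε v x, FunctionSpaces.Torus.gradient (δ ⋆ k) x⟫_ℝ =
        ∑ j, ((fun y => v y j) ⋆ k) x * (δ ⋆ k) x * FunctionSpaces.Torus.partialDeriv j (δ ⋆ k) x := by
      intro x
      rw [FunctionSpaces.Torus.inner_gradient_eq_sum_mul_partialDeriv hA1, Finset.mul_sum]
      refine Finset.sum_congr rfl fun j _ => ?_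
      rw [FunctionSpaces.Torus.vecMollify_apply]
      ring
    rw [integral_congr_ae (Eventually.of_forall hpt), integral_finsetSum _ fun j _ => hJ j] at h0
    exact h0
  -- Step 4: subtract
  have hK : ∀ j, Integrable (fun x => ((fun y => v y j * δ y) ⋆ k) x *
      FunctionSpaces.Torus.partialDeriv j (δ ⋆ k) x) volume := fun j =>
    ((FunctionSpaces.Torus.continuous_convolution (hvI j).2.2 hkc).mul
      (hA.partialDeriv j).continuous).integrable_unitAddTorus
  rw [hlhs, ← sub_zero (∑ j, ∫ x, ((fun y => v y j * δ y) ⋆ k) x * FunctionSpaces.Torus.partialDeriv j (δ ⋆ k) x),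
    ← hzero, ← Finset.sum_sub_distrib]
  refine Finset.sum_congr rfl fun j _ => ?_
  rw [← integral_sub (hK j) (hJ j)]
  refine integral_congr_ae (Eventually.of_forall fun x => ?_)
  ring

/-- **The slice bound in Hölder classes** (DEIJ 2022, proof of Thm. 4, (5.10), per unit
time): for continuous `δ ∈ C^β` (Hölder constant `C_θ`), a bounded measurable weakly
divergence-free `v ∈ C^α` (Hölder constant `C_u`), `0 < ε ≤ 1/4`, `κ ≥ 0`, `k = kernel ε`,
`A = δ ⋆ k` and the flux `G(x) = ∫ δ(y) (-⟪v y, ∇k(x-y)⟫ + κ Δk(x-y)) dy`,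
`-∫ A G = κ ∫ ‖∇A‖² - ∫ δ ⟪v, ∇B⟫ ≤ d · P · Q + κ · d · P²`, where
`P = (C₁/ε) C_θ ε^β` bounds `|∂ⱼA|` and `Q = 2 C_u ε^α C_θ ε^β` bounds the commutator `|τⱼ|`
(`Torus.abs_partialDeriv_convolution_kernel_le`, `Torus.abs_commutator_le`), i.e. the bound
`ℓ^{α+2β-1}[θ]²_β[u]_α + κ ℓ^{2(β-1)}[θ]²_β` up to the constants `d`, `C₁`.
[cite: DrivasEtAl2022, proof of Thm. 4, (5.10)] -/
theorem neg_integral_conv_mul_flux_le_of_holderWith (hδ : Continuous δ) {Cθ β : ℝ≥0}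
    (hδH : HolderWith Cθ β δ) (hv : AEStronglyMeasurable v volume) (hCv : ∀ y, ‖v y‖ ≤ Cv)
    {Cu α : ℝ≥0} (hvH : HolderWith Cu α v) (hdiv : FunctionSpaces.Torus.IsWeaklyDivFree v)
    (hε : 0 < ε) (hε' : ε ≤ 1 / 4) {κ : ℝ} (hκ : 0 ≤ κ) :
    -(∫ x, (δ ⋆ FunctionSpaces.Torus.kernel ε) x * ∫ y, δ y *
        (-⟪v y, FunctionSpaces.Torus.gradient (FunctionSpaces.Torus.kernel ε) (x - y)⟫_ℝ +
          κ * FunctionSpaces.Torus.laplacian (FunctionSpaces.Torus.kernel ε) (x - y))) ≤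
      Fintype.card d * (ε⁻¹ * FunctionSpaces.Torus.gradProfileMass d * (Cθ * ε ^ (β : ℝ))) *
          (2 * (Cu * ε ^ (α : ℝ) * (Cθ * ε ^ (β : ℝ)))) +
        κ * (Fintype.card d * (ε⁻¹ * FunctionSpaces.Torus.gradProfileMass d * (Cθ * ε ^ (β : ℝ))) ^ 2) := by
  set k : UnitAddTorus d → ℝ := FunctionSpaces.Torus.kernel ε with hk_def
  have hk : FunctionSpaces.Torus.IsSmooth k := FunctionSpaces.Torus.isSmooth_kernel hε hε'
  have hδi : Integrable δ volume := hδ.integrable_unitAddTorus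
  have hA : FunctionSpaces.Torus.IsSmooth (δ ⋆ k) := FunctionSpaces.Torus.isSmooth_convolution hδi hk
  have hA1 : FunctionSpaces.Torus.IsContDiff 1 (δ ⋆ k) := hA.isContDiff (by simp)
  have hvI := fun j => integrable_apply_mul_of_norm_le hδ hv hCv j
  rw [integral_conv_mul_flux_eq hδi hv (Eventually.of_forall hCv) hε hε' κ, neg_sub]
  set P : ℝ := ε⁻¹ * FunctionSpaces.Torus.gradProfileMass d * (Cθ * ε ^ (β : ℝ)) with hP
  set Q : ℝ := 2 * (Cu * ε ^ (α : ℝ) * (Cθ * ε ^ (β : ℝ))) with hQ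
  have hP0 : 0 ≤ P :=
    mul_nonneg (mul_nonneg (inv_nonneg.2 hε.le) FunctionSpaces.Torus.gradProfileMass_nonneg) (by positivity)
  have hPj : ∀ j x, |FunctionSpaces.Torus.partialDeriv j (δ ⋆ k) x| ≤ P := fun j x =>
    FunctionSpaces.Torus.abs_partialDeriv_convolution_kernel_le hδi hδH hε hε' j x
  have hτ : ∀ j x, |((fun y => v y j * δ y) ⋆ k) x - ((fun y => v y j) ⋆ k) x * (δ ⋆ k) x| ≤ Q :=
    fun j x => FunctionSpaces.Torus.abs_commutator_le (hvI j).2.1 hδi (hvI j).2.2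
      (FunctionSpaces.Torus.holderWith_apply hvH j) hδH hε hε' x
  -- (a) the transport pairing
  have ha : |∫ y, δ y * ⟪v y, FunctionSpaces.Torus.gradient ((δ ⋆ k) ⋆ k) y⟫_ℝ| ≤ Fintype.card d * P * Q := by
    rw [integral_mul_inner_gradient_conv_conv_eq_sum hδ hv hCv hdiv hε hε']
    refine (Finset.abs_sum_le_sum_abs _ _).trans ?_
    have hj : ∀ j, |∫ x, FunctionSpaces.Torus.partialDeriv j (δ ⋆ k) x *
        (((fun y => v y j * δ y) ⋆ k) x - ((fun y => v y j) ⋆ k) x * (δ ⋆ k) x)| ≤ P * Q := by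
      intro j
      have h := norm_integral_le_of_norm_le (μ := (volume : Measure (UnitAddTorus d)))
        (f := fun x => FunctionSpaces.Torus.partialDeriv j (δ ⋆ k) x *
          (((fun y => v y j * δ y) ⋆ k) x - ((fun y => v y j) ⋆ k) x * (δ ⋆ k) x))
        (integrable_const (P * Q)) (Eventually.of_forall fun x => by
          rw [norm_mul, Real.norm_eq_abs, Real.norm_eq_abs]
          exact mul_le_mul (hPj j x) (hτ j x) (abs_nonneg _) hP0)
      simpa using h
    calc ∑ j, |∫ x, FunctionSpaces.Torus.partialDeriv j (δ ⋆ k) x *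
          (((fun y => v y j * δ y) ⋆ k) x - ((fun y => v y j) ⋆ k) x * (δ ⋆ k) x)|
        ≤ ∑ _j : d, P * Q := Finset.sum_le_sum fun j _ => hj j
      _ = Fintype.card d * P * Q := by
          rw [Finset.sum_const, Finset.card_univ, nsmul_eq_mul]
          ring
  -- (b) the resolved dissipation
  have hb : ∫ x, ‖FunctionSpaces.Torus.gradient (δ ⋆ k) x‖ ^ 2 ≤ Fintype.card d * P ^ 2 := by
    have hpt : ∀ x, ‖FunctionSpaces.Torus.gradient (δ ⋆ k) x‖ ^ 2 ≤ Fintype.card d * P ^ 2 := by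
      intro x
      rw [EuclideanSpace.norm_sq_eq]
      calc ∑ j, ‖FunctionSpaces.Torus.gradient (δ ⋆ k) x j‖ ^ 2 ≤ ∑ _j : d, P ^ 2 := by
            refine Finset.sum_le_sum fun j _ => ?_
            rw [FunctionSpaces.Torus.gradient_apply hA1, Real.norm_eq_abs]
            exact pow_le_pow_left₀ (abs_nonneg _) (hPj j x) 2
        _ = Fintype.card d * P ^ 2 := by
            rw [Finset.sum_const, Finset.card_univ, nsmul_eq_mul]
    calc ∫ x, ‖FunctionSpaces.Torus.gradient (δ ⋆ k) x‖ ^ 2 ≤ ∫ _x : UnitAddTorus d, (Fintype.card d * P ^ 2 : ℝ) :=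
          integral_mono ((hA.gradient.continuous.norm.pow 2 :
            Continuous fun x => ‖FunctionSpaces.Torus.gradient (δ ⋆ k) x‖ ^ 2).integrable_unitAddTorus)
            (integrable_const _) hpt
      _ = Fintype.card d * P ^ 2 := by simp
  have ha' := (neg_le_abs _).trans ha
  have hb' := mul_le_mul_of_nonneg_left hb hκ
  linarith

end Slice

end Torus

end Literature.Analysis.FluidPDE
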